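import Summits.ResolutionOfSingularities.ResolutionOfSingularities.Theorems.PurelyInseparableDim4ResConeLSectorKillPrime
import Summits.ResolutionOfSingularities.ResolutionOfSingularities.Theorems.PurelyInseparableDim4ResConeTranslatedStepWitness
import Summits.ResolutionOfSingularities.ResolutionOfSingularities.Theorems.PurelyInseparableDim4ResConeCornerWalls
import HarnessLib
import HarnessLib.Audit.Tags

/-!
# Purely inseparable four-folds — THE δ-CALCULUS OF A TRANSLATED STEP: exact exponent and AXIS-ORDER laws of one point step with an
# arbitrary chart point (cell `res-dim4-pi`, K2(p) lane, B-LOSSY tool-box, SUPPORT half; holder ruling g5-25 (a) GO)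

[OURS · counted 0 · cell `res-dim4-pi` · K2(p) lane (holder res-dim4-p-12 g5, rulings g5-25: «(a) δ-calculus of a translated step — the support /
axis-order half of the B-LOSSY tool-box»; the COEFFICIENT half «witness survival» is res-dim4-p-11 g6's (A′)) · seat res-dim4-p-5 g6.]  Nothing here
proves any TAIL(p, d, e), K2(7), K2(p), `NoIsolatedTrap p p` or resolution of singularities in dimension ≥ 4 / characteristic `p` — NOT proved;
pure exponent bookkeeping about ONE step of OUR frame's walk.  AI kernel work, weaker than expert review.

ONE STEP at the chart point `b` of the `x_j`-chart (`b_j = 0`, `q ≤ ord F`): `F′ = clean (chart_j (shear_j^b F))`, `shear: x_i ↦ x_i + b_i x_j`.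
* §1 THE EXACT SHEAR LAW is res-dim4-p-11 g6's `preceq_of_mem_support_shear_monomial` / `apply_self_le_of_mem_support_shear_monomial`
  (`…TranslatedStepWitness`, p724675, the COEFFICIENT half of the tool-box): a monomial `x^μ` of `shear_j^b (x^m)` has `|μ| = |m|`, `μ_l = m_l`
  at every UNTRANSLATED letter `l ≠ j`, `μ_i ≤ m_i` at every translated letter, `μ_j ≥ m_j`.  This file is its SUPPORT / axis-order sequel.
* §2 (file §1) THE CHILD LAW (`exists_parent_of_mem_support_step`): every monomial `x^X` of `F′` has a PARENT `x^m` in `F` with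
  `X_j + q = |m|`, `X_l = m_l` (untranslated `l ≠ j`), `X_i ≤ m_i` (translated `i`), and with the SHEAR AMOUNT `λ := Σ_{i ≠ j} (m_i − X_i)`:
  `|X| + q + λ + m_j = 2|m|`.  (Pure corner: `λ = 0`, res-dim4-p-5 g6's `…LSectorKillPrime` / `…PureCornerTail`.)
* §3 (file §2) THE AXIS-ORDER TRANSPORT (`axisOrder_child`), `w_l(E) := Σ_{m ≠ l} E_m` = the order of `x^E` along the `x_l`-axis (the data of the
  pure-corner DRIFT `…PureCornerDrift`, `δ_l = w_l − p`):  **`w_j(X) + λ = w_j(m)`** and, for every `l ≠ j`,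
  **`w_l(X) + q + λ = w_l(m) + w_j(m) + (m_l − X_l)`** — so a translated child is the PURE child (`w_l ↦ w_l + w_j − q`, `w_j` fixed)
  shifted DOWN by the shear amount `λ` on every axis, and back UP by its own loss `m_l − X_l` on a translated axis; in particular for a
  SINGLE translated letter `i` the `x_i`-axis order moves EXACTLY as in a pure corner (`axisOrder_child_single`: shear-blind), and the budget
  law `Σ_{i≠j} X_i + λ = Σ_{i≠j} m_i` bounds the shear by the parent's off-chart mass.
* §4 (file §3) `chain_child_law` — the same along a witnessed chain (`q = p`, chart `j k`, point `b k`).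
[cite: Hauser2010, §§F–G (chart expressions of a point blowup; cleaning), §I (P⁺ = P(y + t·y_j))] [cite: CossartJannsenSaito2020, Lemma 13.2]
bears_on: LADDER-RESOLUTION:D157-DOOR2 (res-dim4-pi · K2(p) B-LOSSY tool-box · δ-calculus of a translated step).  Supports
stmt-ResolutionOfSingularities-16155 (helper).
-/

set_option linter.dupNamespace false -- mandated namespace of this single-conjunct summit

noncomputable section

namespace Summit.ResolutionOfSingularities.ResolutionOfSingularities.Theorems.PIDim4

namespace ResCone

open MvPolynomial Finset
open Literature.AlgebraicGeometry.Resolution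
open Literature.AlgebraicGeometry.Resolution.CentreBlowup
open Literature.AlgebraicGeometry.Resolution.Hauser2010
open Literature.AlgebraicGeometry.Resolution.HauserPerlega2019

variable {K : Type} [Field K]

/-! ## 1. The child law of one step -/

variable [DecidableEq K]

/-- **THE CHILD LAW of a point step** at the chart point `b` of the `x_j`-chart (`b_j = 0`, `q ≤ ord F`): every monomial `x^X` of the new `F`
has a PARENT `x^m` in `F` with `X_j + q = |m|`, `X_l = m_l` at every untranslated `l ≠ j`, `X_i ≤ m_i` at every `i ≠ j`, and, with the SHEAR
AMOUNT `λ = Σ_{i ≠ j} (m_i − X_i)`: `|X| + q + λ + m_j = 2|m|`. [OURS · bookkeeping] [cite: Hauser2010, §§F–G, §I] -/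
theorem exists_parent_of_mem_support_step (q : ℕ) (j : Fin 4) {b : Fin 4 → K} (hbj : b j = 0) (s : State K)
    (hq : (q : ℕ∞) ≤ ordAlong Finset.univ s.F) {X : Fin 4 →₀ ℕ}
    (hX : X ∈ (CentreBlowup.step q Finset.univ j b s).F.support) :
    ∃ m ∈ s.F.support, X j + q = m.degree ∧ (∀ l, l ≠ j → b l = 0 → X l = m l) ∧ (∀ i, i ≠ j → X i ≤ m i) ∧
      X.degree + q + (∑ i ∈ Finset.univ.erase j, (m i - X i)) + m j = 2 * m.degree := by
  classical
  obtain ⟨μ, hμ, hμX, -⟩ := exists_of_mem_support_step q j hbj s hq hX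
  obtain ⟨m, hm, hμm⟩ := exists_monomial_of_mem_support_shear j b s.F hμ
  obtain ⟨hdeg, hkept, hle⟩ := preceq_of_mem_support_shear_monomial j hbj m hμm
  have hqm : q ≤ m.degree := by
    have h := le_ordAlong_iff.mp hq m hm
    rw [degIn_univ] at h
    exact_mod_cast h
  have hXj : X j + q = m.degree := by
    rw [← hμX, chartExponent_univ_apply_self, hdeg]; omega
  have hXl : ∀ l, l ≠ j → X l = μ l := fun l hlj => by rw [← hμX, chartExponent_apply_of_ne q _ hlj]
  refine ⟨m, hm, hXj, fun l hlj hbl => by rw [hXl l hlj, (hkept l hlj hbl).symm], fun i hij => by rw [hXl i hij]; exact hle i hij, ?_⟩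
  -- degrees: `|X| = Σ_{i≠j} X_i + X_j`, `|μ| = Σ_{i≠j} μ_i + μ_j = |m|`, `X_i = μ_i` off `j`
  have h1 := degIn_erase_add_apply j X
  have h2 := degIn_erase_add_apply j μ
  have h3 := degIn_erase_add_apply j m
  have hsumX : degIn (Finset.univ.erase j) X = degIn (Finset.univ.erase j) μ := by
    unfold degIn
    exact Finset.sum_congr rfl fun i hi => hXl i (Finset.ne_of_mem_erase hi)
  -- `Σ_{i≠j} (m_i − X_i) + Σ_{i≠j} X_i = Σ_{i≠j} m_i` (termwise, `X_i ≤ m_i`)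
  have hlam : (∑ i ∈ Finset.univ.erase j, (m i - X i)) + degIn (Finset.univ.erase j) X = degIn (Finset.univ.erase j) m := by
    unfold degIn
    rw [← Finset.sum_add_distrib]
    exact Finset.sum_congr rfl fun i hi => Nat.sub_add_cancel (by rw [hXl i (Finset.ne_of_mem_erase hi)]; exact hle i (Finset.ne_of_mem_erase hi))
  omega

/-! ## 2. The axis-order transport -/

/-- **THE AXIS-ORDER TRANSPORT OF A TRANSLATED STEP.**  With the parent `x^m` and shear amount `λ` of `exists_parent_of_mem_support_step` and
`w_l := degIn (univ.erase l)` (the order along the `x_l`-axis): the chart axis loses exactly the shear, **`w_j(X) + λ = w_j(m)`**, and every other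
axis obeys **`w_l(X) + q + λ = w_l(m) + w_j(m) + (m_l − X_l)`** — the pure-corner law `w_l ↦ w_l + w_j − q` shifted down by `λ` and up by the
letter's own loss (zero at an untranslated letter). [OURS] [cite: Hauser2010, §§F–G, §I] -/
theorem axisOrder_child (q : ℕ) (j : Fin 4) {b : Fin 4 → K} (hbj : b j = 0) (s : State K)
    (hq : (q : ℕ∞) ≤ ordAlong Finset.univ s.F) {X : Fin 4 →₀ ℕ}
    (hX : X ∈ (CentreBlowup.step q Finset.univ j b s).F.support) :
    ∃ m ∈ s.F.support, (∀ l, l ≠ j → b l = 0 → X l = m l) ∧ (∀ i, i ≠ j → X i ≤ m i) ∧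
      degIn (Finset.univ.erase j) X + (∑ i ∈ Finset.univ.erase j, (m i - X i)) = degIn (Finset.univ.erase j) m ∧
      ∀ l, l ≠ j → degIn (Finset.univ.erase l) X + q + (∑ i ∈ Finset.univ.erase j, (m i - X i)) =
        degIn (Finset.univ.erase l) m + degIn (Finset.univ.erase j) m + (m l - X l) := by
  obtain ⟨m, hm, hXj, hkept, hle, hdeg⟩ := exists_parent_of_mem_support_step q j hbj s hq hX
  refine ⟨m, hm, hkept, hle, ?_, fun l hlj => ?_⟩
  · have h1 := degIn_erase_add_apply j X
    have h3 := degIn_erase_add_apply j m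
    omega
  · have h1 := degIn_erase_add_apply l X
    have h2 := degIn_erase_add_apply j X
    have h3 := degIn_erase_add_apply l m
    have h4 := degIn_erase_add_apply j m
    have h5 := hle l hlj
    omega

/-- **SINGLE TRANSLATED LETTER: its own axis is SHEAR-BLIND.**  If `b` is supported on one letter `i ≠ j` (`b_l = 0` for `l ≠ i`), every
monomial `x^X` of the new `F` has a parent `x^m` with `w_i(X) + q = w_i(m) + w_j(m)` exactly — the pure-corner law on the `x_i`-axis — while
`w_j(X) + λ = w_j(m)` and `w_l(X) + q + λ = w_l(m) + w_j(m)` (`l ∉ {i, j}`) with `λ = m_i − X_i`. [OURS] [cite: Hauser2010, §§F–G, §I] -/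
theorem axisOrder_child_single (q : ℕ) {j i : Fin 4} (hij : i ≠ j) {b : Fin 4 → K} (hb : ∀ l, l ≠ i → b l = 0) (s : State K)
    (hq : (q : ℕ∞) ≤ ordAlong Finset.univ s.F) {X : Fin 4 →₀ ℕ}
    (hX : X ∈ (CentreBlowup.step q Finset.univ j b s).F.support) :
    ∃ m ∈ s.F.support, X i ≤ m i ∧ (∀ l, l ≠ j → l ≠ i → X l = m l) ∧
      degIn (Finset.univ.erase i) X + q = degIn (Finset.univ.erase i) m + degIn (Finset.univ.erase j) m ∧
      degIn (Finset.univ.erase j) X + (m i - X i) = degIn (Finset.univ.erase j) m ∧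
      ∀ l, l ≠ j → l ≠ i → degIn (Finset.univ.erase l) X + q + (m i - X i) =
        degIn (Finset.univ.erase l) m + degIn (Finset.univ.erase j) m := by
  obtain ⟨m, hm, hkept, hle, hj, hall⟩ := axisOrder_child q j (hb j hij.symm) s hq hX
  -- the shear amount is `m_i − X_i`: all other summands vanish
  have hlam : ∑ l ∈ Finset.univ.erase j, (m l - X l) = m i - X i := by
    rw [Finset.sum_eq_single_of_mem i (Finset.mem_erase.mpr ⟨hij, Finset.mem_univ i⟩)]
    intro l hl hli
    rw [hkept l (Finset.ne_of_mem_erase hl) (hb l hli), Nat.sub_self]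
  refine ⟨m, hm, hle i hij, fun l hlj hli => hkept l hlj (hb l hli), ?_, by rw [← hlam]; exact hj, fun l hlj hli => ?_⟩
  · have h := hall i hij
    rw [hlam] at h
    have h5 := hle i hij
    omega
  · have h := hall l hlj
    rw [hlam, hkept l hlj (hb l hli), Nat.sub_self, add_zero] at h
    exact h

/-! ## 3. Along a witnessed chain -/

/-- **THE CHILD LAW ALONG A WITNESSED CHAIN**: for every `k` and every monomial `x^X` of `F_{k+1}` there is a parent `x^m` in `F_k` with the
exponent laws of `exists_parent_of_mem_support_step` and the axis-order laws of `axisOrder_child` for the chart `j k` and the point `b k`.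
[OURS] [cite: Hauser2010, §§F–G, §I] -/
theorem chain_child_law (p : ℕ) {c : ℕ → State K} {j : ℕ → Fin 4} {b : ℕ → Fin 4 → K}
    (hw : FreeTail.IsWitnessedChain p c j b) (k : ℕ) {X : Fin 4 →₀ ℕ} (hX : X ∈ (c (k + 1)).F.support) :
    ∃ m ∈ (c k).F.support, X (j k) + p = m.degree ∧ (∀ l, l ≠ j k → b k l = 0 → X l = m l) ∧ (∀ i, i ≠ j k → X i ≤ m i) ∧
      X.degree + p + (∑ i ∈ Finset.univ.erase (j k), (m i - X i)) + m (j k) = 2 * m.degree ∧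
      degIn (Finset.univ.erase (j k)) X + (∑ i ∈ Finset.univ.erase (j k), (m i - X i)) = degIn (Finset.univ.erase (j k)) m ∧
      ∀ l, l ≠ j k → degIn (Finset.univ.erase l) X + p + (∑ i ∈ Finset.univ.erase (j k), (m i - X i)) =
        degIn (Finset.univ.erase l) m + degIn (Finset.univ.erase (j k)) m + (m l - X l) := by
  obtain ⟨hq, hbj, -, -, hstep⟩ := hw k
  rw [hstep] at hX
  obtain ⟨m, hm, hXj, hkept, hle, hdeg⟩ := exists_parent_of_mem_support_step p (j k) hbj (c k) hq hX
  refine ⟨m, hm, hXj, hkept, hle, hdeg, ?_, fun l hlj => ?_⟩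
  · have h1 := degIn_erase_add_apply (j k) X
    have h3 := degIn_erase_add_apply (j k) m
    omega
  · have h1 := degIn_erase_add_apply l X
    have h2 := degIn_erase_add_apply (j k) X
    have h3 := degIn_erase_add_apply l m
    have h4 := degIn_erase_add_apply (j k) m
    have h5 := hle l hlj
    omega

end ResCone

end Summit.ResolutionOfSingularities.ResolutionOfSingularities.Theorems.PIDim4

end
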